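import Summits.BirchSwinnertonDyer.Rank1Residual.Additive.TameBranchGrossZagierOfTwisted
import Summits.BirchSwinnertonDyer.Rank1Residual.Additive.TameBranchGrossZagierOfTwistedOdd
import Summits.BirchSwinnertonDyer.Rank1Residual.Additive.TameBranchOfTwistBranchMult
import Summits.BirchSwinnertonDyer.Rank1Residual.Additive.TameBranchGrossZagierCellFact
import Summits.BirchSwinnertonDyer.Rank1Residual.AdditivePotMult.PStarTwistModel
import Summits.BirchSwinnertonDyer.Rank1Residual.AdditivePotMult.PotMultDelbourgo2002Bridge
import Summits.BirchSwinnertonDyer.Rank1Residual.AdditivePotMult.TwistSupplyJClass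
import HarnessLib

/-!
# Row B6 (O7-ord), defect 2, E-NORMALISED CURRENCY on the potentially MULTIPLICATIVE locus (M): the
# typed tame-branch `p`-adic Gross–Zagier formula `TameBranchPAdicGrossZagierAt W p Dh` from the
# twisted-branch clauses, both parities — and hence on the WHOLE potentially-ordinary additive locus
# at `p ≥ 5` in analytic rank one, ONE datum carries Delbourgo (B) and the E-normalised formula
# (cell `bsd-addord`, seat `bsd-addord-gz`, session 3; (M) twin of `TameBranchGrossZagierOfTwisted{,Odd}.lean`)

HONEST FRAMING. Theorems only: no definition, no named fact, no `sorry`, nothing booked, labels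
UNCHANGED. On (M) the semistable twist `V = E ⊗ χ_{p*}` is MULTIPLICATIVE at `p` (`a_p(V) = ±1`,
`p ∣ N_V`), the E-normalised tame branch is `C(c)·L^{±}_p(f_V, a_p(V), ω^{(p−1)/2}, T)` (one-term
branch; dictionary `TameBranchOfTwistBranchMult.lean`) with the SAME Legendre constant `c` as on
(G-ord) — normalised by `exists_legendreTwistPlusRel_eq_periodIndex` /
`exists_legendreTwistMinusRel_eq_periodIndex` (Pal 2012 needs only semistability of `V` at `p`). So
§1–§2 repeat the (G-ord) argument with the (M) clause of `TwistedBranchGrossZagierAt` and tuple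
rigidity; §3 assembles: on (M) (`AdditivePotMult.PotMult W p`, every odd `p`) and therefore on the
whole potentially-ordinary additive locus at `p ≥ 5` — (M) ∪ (G-ord, `e = 2`) from the defect-2 fact
`Disegni2017.delbourgoDatum_rankOne_leadingTerms` (`hFact`, REF-gz PASS with GZ-H), (G-ord,
`e ∈ {3,4,6}`) from the cell `Prop` `tameBranch_delbourgoDatum_rankOne_leadingTerms` (`hFact2`, REF-gz2
PASS with GZ-H2) — `∃ Dh, LeadingTermClauses W p Dh ∧ TameBranchPAdicGrossZagierAt W p Dh`, and the
L3.N1″ HEADLINE of `TameBranchGrossZagier.lean` supplied uniformly. REFEREE CONDITION GZ-H (binding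
on these (M) statements, which cover `V` SPLIT multiplicative; verbatim in substance): the height
identification behind `hFact`'s Gross–Zagier half on (M) ∩ {`V` split} is the (n-exc)-CONDITIONAL
printed sentence Disegni, Compos. Math. 153 (2017) Rem. 1.3.2 (arXiv v3 p. 9) together with Disegni,
Invent. Math. 230 (2022) Thm. B context (and its 2025 Correction), with (n-exc) DISCHARGED because
`ε_p` is ramified (PROOF-gz 3.1 (iv): `Z_w ≠ 0` also for split `V`); it is NOT Delbourgo 2002 p. 62's
unconditional sentence, and Nekovář 1993 §7.14 is not held on the hub (acq-10827), so the
verification trail is the printed statements of Disegni 2017/2022. CONDITION GZ-H2 (for `hFact2`):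
see `TameBranchGrossZagierCellFact.lean`.

## What is NOT claimed

Nothing asserted beyond the displayed binders; no booking; no UPPER half; `p = 3` on (M) is inside
§1–§2 (any odd `p`) but §3's uniform statement is `p ≥ 5` (the (G) facts need it).

References: [Pal2012] Thm. 3.2, Prop. 2.5; [MazurTateTeitelbaum1986Invent] §I.8, §I.13–I.14;
[Shimura1971] Prop. 3.64; [Delbourgo2002] Thm. (A), (B), (C) p. 40, Hypothesis (M) p. 39;
[Disegni2017] Thm. B, Rem. 1.3.2; [Miller2011LMS] Def. 1.1; cell memos PROOF-gz.md §3 (Thm. 1 on (M)),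
PROOF-gz2.md Remark 0.3.
-/

noncomputable section

open scoped Classical MatrixGroups ModularForm NumberField

open CongruenceSubgroup WeierstrassCurve NumberField IsDedekindDomain
  Literature.NumberTheory.EllipticCurves Literature.NumberTheory.EllipticCurves.ModularForms
  Literature.NumberTheory.EllipticCurves.Rank1Residual
  Literature.NumberTheory.EllipticCurves.Rank1Residual.Typed
  Literature.NumberTheory.EllipticCurves.Delbourgo2002
  Literature.NumberTheory.EllipticCurves.Disegni2017

namespace Summit.BirchSwinnertonDyer.Rank1Residual.Additive

variable {W : WeierstrassCurve ℚ} [W.IsElliptic] [W.IsGloballyMinimal] {p : ℕ} [hp : Fact p.Prime]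

/-! ### §1 (M), `p ≡ 1 (mod 4)`: E-currency from the (M) clause of the twisted-branch `Prop` -/

/-- **E-currency from V-currency on (M), even branch.** For `E = W` additive at `p ≡ 1 (mod 4)` with a
MULTIPLICATIVE twist model `C • V^{(p)} = W`, `r_an(E) = 1`, and a datum `Dh` carrying
`TwistedBranchGrossZagierAt W p Dh`: `TameBranchPAdicGrossZagierAt W p Dh` holds (every tuple of the
E-normalised package). Dictionary `isTameBranchOf_legendre_C_mul_padicLFunctionPlusBranchMult`
(`a_p(V) = ±1`, `p ∣ N_V` by `LFunction_eq_or_eq_neg_and_dvd_level_of_mult`), rigidity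
`IsTameBranchOf.eq_zero_or_tuple_eq`, normalised constant `c = ±ϖ_V/ϖ_E`. GZ-H applies (module
docstring). [cite: Pal2012, Thm. 3.2] [cite: MazurTateTeitelbaum1986Invent, §I.10, §I.13–I.14]
[cite: Disegni2017, Thm. B (§1.3.2) and Rem. 1.3.2 (provenance of the clause `hTw`; nothing asserted)] -/
theorem tameBranchPAdicGrossZagierAt_of_twisted_of_mult_twist (hp4 : p % 4 = 1)
    (hmodD : nonempty_modularParametrizationData)
    (hGZK : rank_eq_analyticRank_of_analyticRank_le_one) (hadd : Addv W p)
    (V : WeierstrassCurve ℚ) [V.IsElliptic] [V.IsGloballyMinimal]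
    (hVW : ∃ C : VariableChange ℚ, C • V.quadraticTwist (p : ℚ) = W) (hV : Mult V p)
    (hr : W.analyticRank = 1) {Dh : PAdicHeightData W p} (hTw : TwistedBranchGrossZagierAt W p Dh) :
    TameBranchPAdicGrossZagierAt W p Dh := by
  intro N _ f ε α B hf _hε hα hB ϖ hϖ
  have hp2 : p ≠ 2 := by omega
  have hmw : W.mordellWeilRank = 1 := by rw [(hGZK W (by rw [hr])).1, hr]
  haveI : NeZero (V.conductorNorm ℤ) := ⟨(V.conductorNorm_pos_holds).ne'⟩
  obtain ⟨Dm⟩ := hmodD V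
  obtain ⟨ϖ', -, hϖ', -⟩ := Dm.exists_rat_mul_realPeriodRat_eq_plusPeriod
  obtain ⟨C, hC⟩ := hVW
  obtain ⟨c, hrel, hc⟩ := exists_legendreTwistPlusRel_eq_periodIndex hp4 V W ⟨C, hC⟩ hadd
    (Or.inr hV) hf Dm.isNewformOf ϖ ϖ' hϖ hϖ'
  obtain ⟨hap1, hpN⟩ := LFunction_eq_or_eq_neg_and_dvd_level_of_mult V hV Dm.isNewformOf
  have hnamed := isTameBranchOf_legendre_C_mul_padicLFunctionPlusBranchMult hp2 Dm.isNewformOf.1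
    Dm.isNewformOf.coeffField_eq_bot hpN (Dm.isNewformOf.2 p) hap1 hrel
  obtain ⟨-, hα0'⟩ := norm_intCast_eq_one_of_eq_one_or_eq_neg_one (p := p) hap1
  -- the V-clause, (M) even
  obtain ⟨q, hlead, heven, -⟩ := hTw hr V Dm.f (Or.inr hV) Dm.isNewformOf
  obtain ⟨u, hu⟩ := (heven C ϖ' hp4 hC hϖ').2 hV
  rw [hmw, pow_one]
  have hϖ0 : ϖ ≠ 0 := X2.varpi_ne_zero_of_isNewformOf hf hϖ
  have hϖ'0 : ϖ' ≠ 0 := X2.varpi_ne_zero_of_isNewformOf Dm.isNewformOf hϖ'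
  have hϖQ : ((ϖ : ℚ) : ℚ_[p]) ≠ 0 := by exact_mod_cast hϖ0
  have hc0 : (c : ℚ_[p]) ≠ 0 := by
    have : c ≠ 0 := by
      rcases hc with hc | hc <;> rw [hc]
      · exact div_ne_zero hϖ'0 hϖ0
      · exact neg_ne_zero.mpr (div_ne_zero hϖ'0 hϖ0)
    exact_mod_cast this
  set L := padicLFunctionPlusBranchMult Dm.f ((V.LFunction p : ℤ) : ℚ_[p]) (p / 2) with hL
  by_cases hBn : PowerSeries.C (c : ℚ_[p]) * L = 0
  · have hL0 : L = 0 := by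
      rcases mul_eq_zero.mp hBn with h | h
      · exact absurd (by simpa using congrArg (PowerSeries.constantCoeff) h) hc0
      · exact h
    have hB0 : B = 0 := by
      by_contra hB0
      rcases hB.eq_zero_or_tuple_eq hp2 hnamed hB0 with ⟨hα0, -⟩ | ⟨-, -, hBB⟩
      · exact hα0' hα0
      · exact hB0 (hBB ▸ hBn)
    have hqR : (q : ℚ_[p]) * padicRegulator Dh = 0 := by
      have h0 : (ϖ' : ℚ_[p]) * PowerSeries.coeff 1 L * padicLog p (cyclotomicGenerator p) = 0 := by
        rw [hL0, map_zero, mul_zero, zero_mul]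
      rw [hu, mul_assoc] at h0
      rcases mul_eq_zero.mp h0 with h | h
      · exact absurd h (coe_units_ne_zero p u)
      · exact h
    refine ⟨u, q, hlead, ?_⟩
    rw [hB0, map_zero, mul_zero, zero_mul, mul_assoc, hqR, mul_zero]
  · rcases hnamed.eq_zero_or_tuple_eq hp2 hB hBn with ⟨hα0, -⟩ | ⟨-, -, hBB⟩
    · exact absurd (by rw [hα0, norm_zero] : ‖α‖ = 0) (by rw [hα]; exact one_ne_zero)
    · rcases hc with hc | hc
      · refine ⟨u, q, hlead, ?_⟩
        rw [hBB, PowerSeries.coeff_C_mul, hc, ← hu]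
        push_cast
        field_simp
      · refine ⟨-u, q, hlead, ?_⟩
        rw [hBB, PowerSeries.coeff_C_mul, hc, Units.val_neg, PadicInt.coe_neg, neg_mul, neg_mul, ← hu]
        push_cast
        field_simp

/-! ### §2 (M), `p ≡ 3 (mod 4)`: the odd branch -/

/-- **E-currency from V-currency on (M), odd branch** (`C • V^{(−p)} = W`, `V` multiplicative at `p`):
`TameBranchPAdicGrossZagierAt W p Dh` from `TwistedBranchGrossZagierAt W p Dh`, analytic rank one;
constant `c = ±ϖ'/(n_E·ϖ)` (`exists_legendreTwistMinusRel_eq_periodIndex`), unit `±u/n_E`. GZ-H applies.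
[cite: Pal2012, Thm. 3.2 (case d < 0)] [cite: MazurTateTeitelbaum1986Invent, §I.10, §I.13–I.14]
[cite: Disegni2017, Thm. B (§1.3.2) and Rem. 1.3.2 (provenance of the clause `hTw`; nothing asserted)] -/
theorem tameBranchPAdicGrossZagierAt_of_twisted_of_mult_twist_odd (hp4 : p % 4 = 3)
    (hmodD : nonempty_modularParametrizationData)
    (hGZK : rank_eq_analyticRank_of_analyticRank_le_one) (hadd : Addv W p)
    (V : WeierstrassCurve ℚ) [V.IsElliptic] [V.IsGloballyMinimal]
    (hVW : ∃ C : VariableChange ℚ, C • V.quadraticTwist (-(p : ℚ)) = W) (hV : Mult V p)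
    (hr : W.analyticRank = 1) {Dh : PAdicHeightData W p} (hTw : TwistedBranchGrossZagierAt W p Dh) :
    TameBranchPAdicGrossZagierAt W p Dh := by
  intro N _ f ε α B hf _hε hα hB ϖ hϖ
  have hp2 : p ≠ 2 := by omega
  have hmw : W.mordellWeilRank = 1 := by rw [(hGZK W (by rw [hr])).1, hr]
  haveI : NeZero (V.conductorNorm ℤ) := ⟨(V.conductorNorm_pos_holds).ne'⟩
  obtain ⟨Dm⟩ := hmodD V
  obtain ⟨ϖ', -, hϖ'⟩ := exists_rat_mul_imaginaryPeriodRat_eq_minusPeriod Dm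
  obtain ⟨C, hC⟩ := hVW
  obtain ⟨c, hrel, hc⟩ := exists_legendreTwistMinusRel_eq_periodIndex hp4 V W ⟨C, hC⟩ hadd
    (Or.inr hV) hf Dm.isNewformOf ϖ ϖ' hϖ hϖ'
  obtain ⟨hap1, hpN⟩ := LFunction_eq_or_eq_neg_and_dvd_level_of_mult V hV Dm.isNewformOf
  have hnamed := isTameBranchOf_legendre_C_mul_padicLFunctionMinusBranchMult hp2 Dm.isNewformOf.1
    Dm.isNewformOf.coeffField_eq_bot hpN (Dm.isNewformOf.2 p) hap1 hrel
  obtain ⟨-, hα0'⟩ := norm_intCast_eq_one_of_eq_one_or_eq_neg_one (p := p) hap1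
  -- the V-clause, (M) odd
  obtain ⟨q, hlead, -, hoddc⟩ := hTw hr V Dm.f (Or.inr hV) Dm.isNewformOf
  obtain ⟨u, hu⟩ := (hoddc C ϖ' hp4 hC hϖ').2 hV
  rw [hmw, pow_one]
  -- the unit `n⁻¹`
  set n : ℕ := (W.baseChange ℝ).numRealComponents with hn
  have hndvd : ¬ p ∣ n := by
    rcases numRealComponents_eq_one_or_two (W.baseChange ℝ) with h1 | h2
    · rw [hn, h1]; intro hd; exact absurd (Nat.le_of_dvd one_pos hd) (by omega)
    · rw [hn, h2]; intro hd; exact absurd (Nat.le_of_dvd two_pos hd) (by omega)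
  obtain ⟨v, hv⟩ := GaloisImage.GroupRingEval.exists_units_coe_eq_natCast (p := p) hndvd
  have hvinv : (((v⁻¹ : ℤ_[p]ˣ) : ℤ_[p]) : ℚ_[p]) = (n : ℚ_[p])⁻¹ := by
    have h2 : ((v⁻¹ : ℤ_[p]ˣ) : ℤ_[p]) * (v : ℤ_[p]) = 1 := v.inv_mul
    have h3 := congrArg ((↑) : ℤ_[p] → ℚ_[p]) h2
    rw [PadicInt.coe_mul, hv, PadicInt.coe_one] at h3
    exact eq_inv_of_mul_eq_one_left h3
  have hϖ0 : ϖ ≠ 0 := X2.varpi_ne_zero_of_isNewformOf hf hϖ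
  have hϖ'0 : ϖ' ≠ 0 := by
    intro h0
    rw [h0, Rat.cast_zero, zero_mul] at hϖ'
    exact (IsNewform0.minusPeriod_pos_holds Dm.isNewformOf.1 Dm.isNewformOf.coeffField_eq_bot).ne' hϖ'.symm
  have hϖQ : ((ϖ : ℚ) : ℚ_[p]) ≠ 0 := by exact_mod_cast hϖ0
  have hn0Q : (n : ℚ) ≠ 0 := by exact_mod_cast (W.baseChange ℝ).numRealComponents_pos.ne'
  have hc0 : (c : ℚ_[p]) ≠ 0 := by
    have : c ≠ 0 := by
      rcases hc with hc | hc <;> rw [hc]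
      · exact div_ne_zero hϖ'0 (mul_ne_zero hn0Q hϖ0)
      · exact neg_ne_zero.mpr (div_ne_zero hϖ'0 (mul_ne_zero hn0Q hϖ0))
    exact_mod_cast this
  set L := padicLFunctionMinusBranchMult Dm.f ((V.LFunction p : ℤ) : ℚ_[p]) (p / 2) with hL
  by_cases hBn : PowerSeries.C (c : ℚ_[p]) * L = 0
  · have hL0 : L = 0 := by
      rcases mul_eq_zero.mp hBn with h | h
      · exact absurd (by simpa using congrArg (PowerSeries.constantCoeff) h) hc0
      · exact h
    have hB0 : B = 0 := by
      by_contra hB0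
      rcases hB.eq_zero_or_tuple_eq hp2 hnamed hB0 with ⟨hα0, -⟩ | ⟨-, -, hBB⟩
      · exact hα0' hα0
      · exact hB0 (hBB ▸ hBn)
    have hqR : (q : ℚ_[p]) * padicRegulator Dh = 0 := by
      have h0 : (ϖ' : ℚ_[p]) * PowerSeries.coeff 1 L * padicLog p (cyclotomicGenerator p) = 0 := by
        rw [hL0, map_zero, mul_zero, zero_mul]
      rw [hu, mul_assoc] at h0
      rcases mul_eq_zero.mp h0 with h | h
      · exact absurd h (coe_units_ne_zero p u)
      · exact h
    refine ⟨u, q, hlead, ?_⟩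
    rw [hB0, map_zero, mul_zero, zero_mul, mul_assoc, hqR, mul_zero]
  · rcases hnamed.eq_zero_or_tuple_eq hp2 hB hBn with ⟨hα0, -⟩ | ⟨-, -, hBB⟩
    · exact absurd (by rw [hα0, norm_zero] : ‖α‖ = 0) (by rw [hα]; exact one_ne_zero)
    · rcases hc with hc | hc
      · refine ⟨u * v⁻¹, q, hlead, ?_⟩
        rw [hBB, PowerSeries.coeff_C_mul, hc, Units.val_mul, PadicInt.coe_mul, hvinv]
        push_cast
        rw [show ((ϖ : ℚ) : ℚ_[p]) * ((ϖ' : ℚ_[p]) / ((n : ℚ_[p]) * (ϖ : ℚ_[p])) * PowerSeries.coeff 1 L) *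
            padicLog p (cyclotomicGenerator p) =
            (n : ℚ_[p])⁻¹ * ((ϖ' : ℚ_[p]) * PowerSeries.coeff 1 L * padicLog p (cyclotomicGenerator p)) by
          field_simp, hu]
        ring
      · refine ⟨-(u * v⁻¹), q, hlead, ?_⟩
        rw [hBB, PowerSeries.coeff_C_mul, hc, Units.val_neg, PadicInt.coe_neg, Units.val_mul,
          PadicInt.coe_mul, hvinv]
        push_cast
        rw [show ((ϖ : ℚ) : ℚ_[p]) * (-((ϖ' : ℚ_[p]) / ((n : ℚ_[p]) * (ϖ : ℚ_[p]))) * PowerSeries.coeff 1 L) *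
            padicLog p (cyclotomicGenerator p) =
            -(n : ℚ_[p])⁻¹ * ((ϖ' : ℚ_[p]) * PowerSeries.coeff 1 L * padicLog p (cyclotomicGenerator p)) by
          field_simp, hu]
        ring

/-! ### §3 (M) and the whole potentially-ordinary locus: ONE datum with (B) and the E-normalised formula -/

/-- **(M), every odd `p`, analytic rank one:** the defect-2 fact (`hFact`) gives ONE datum `Dh` with
Delbourgo's (B)-clauses AND `TameBranchPAdicGrossZagierAt W p Dh` (both parities of `(p−1)/2`; twist
model `PotMult.exists_mult_pStar_twist_model`; Delbourgo's printed (M)-hypothesis discharged by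
`PotMult.exists_quadraticTwist_mult`, no CM by `PotMult.not_hasCM`). GZ-H applies.
[cite: Delbourgo2002, Theorem (B) (p. 40), Hypothesis (M) (p. 39)] [cite: Pal2012, Thm. 3.2]
[cite: Disegni2017, Thm. B (§1.3.2) and Rem. 1.3.2 (provenance of `hFact`; nothing asserted)] -/
theorem potMult_exists_leadingTermClauses_and_tameBranchPAdicGrossZagierAt_of_delbourgoDatumFact
    (hFact : delbourgoDatum_rankOne_leadingTerms) (hmodD : nonempty_modularParametrizationData)
    (hGZK : rank_eq_analyticRank_of_analyticRank_le_one) (hpm : AdditivePotMult.PotMult W p)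
    (hp2 : p ≠ 2) (hr : W.analyticRank = 1) :
    ∃ Dh : PAdicHeightData W p, LeadingTermClauses W p Dh ∧ TameBranchPAdicGrossZagierAt W p Dh := by
  have hodd : p % 4 = 1 ∨ p % 4 = 3 := by
    obtain ⟨k, hk⟩ := hp.out.odd_of_ne_two hp2
    omega
  obtain ⟨Dh, hB, hTw⟩ := hFact W p hp2 hpm.not_hasCM hpm.1 hr
    (Or.inr (Or.inl ⟨hpm.2, hpm.exists_quadraticTwist_mult hp2⟩))
  obtain ⟨V, iV, iVm, C, hV, hC⟩ := hpm.exists_mult_pStar_twist_model hp2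
  rcases hodd with h1 | h3
  · have hC' : C • V.quadraticTwist (p : ℚ) = W := by
      rw [pStar_eq_of_mod_four p (Or.inl h1), if_pos h1] at hC
      exact hC
    have hGZ : TameBranchPAdicGrossZagierAt W p Dh :=
      tameBranchPAdicGrossZagierAt_of_twisted_of_mult_twist h1 hmodD hGZK hpm.1 V ⟨C, hC'⟩ hV hr hTw
    exact ⟨Dh, hB, hGZ⟩
  · have hC' : C • V.quadraticTwist (-(p : ℚ)) = W := by
      rw [pStar_eq_of_mod_four p (Or.inr h3), if_neg (by omega)] at hC
      exact hC
    have hGZ : TameBranchPAdicGrossZagierAt W p Dh :=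
      tameBranchPAdicGrossZagierAt_of_twisted_of_mult_twist_odd h3 hmodD hGZK hpm.1 V ⟨C, hC'⟩ hV hr hTw
    exact ⟨Dh, hB, hGZ⟩

/-- **THE WHOLE POTENTIALLY-ORDINARY ADDITIVE LOCUS, `p ≥ 5`, analytic rank one, non-CM: ONE datum
`Dh` carries Delbourgo 2002 (B) AND the E-normalised tame-branch `p`-adic Gross–Zagier formula
`TameBranchPAdicGrossZagierAt W p Dh`** — GRANTED the two displayed cell inputs: the defect-2 fact
`hFact` ((M) ∪ (G-ord, `e = 2`): PROOF-gz Thm. 1, REF-gz PASS GZ-H; here a THEOREM in E-currency by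
§1–§2 and `TameBranchGrossZagierOfTwisted{,Odd}.lean`) and the defect-3/4/6 `Prop` `hFact2`
(PROOF-gz2 Thm. 2, REF-gz2 PASS GZ-H2). `hloc : AdditivePotMult.PotMult W p ∨ TypeGOrd W p`.
[cite: Delbourgo2002, Theorem (B) (p. 40), Hypotheses (G), (M) (p. 39)]
[cite: Disegni2017, Thm. B (§1.3.2) and Rem. 1.3.2 (provenance; nothing asserted)] -/
theorem exists_leadingTermClauses_and_tameBranchPAdicGrossZagierAt_of_cellFacts
    (hFact : delbourgoDatum_rankOne_leadingTerms) (hFact2 : tameBranch_delbourgoDatum_rankOne_leadingTerms)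
    (hmodD : nonempty_modularParametrizationData) (hGZK : rank_eq_analyticRank_of_analyticRank_le_one)
    (hp5 : 5 ≤ p) (hcm : ¬ W.HasCM) (hadd : Addv W p) (hloc : AdditivePotMult.PotMult W p ∨ TypeGOrd W p)
    (hr : W.analyticRank = 1) :
    ∃ Dh : PAdicHeightData W p, LeadingTermClauses W p Dh ∧ TameBranchPAdicGrossZagierAt W p Dh := by
  have hp2 : p ≠ 2 := by omega
  rcases hloc with hpm | hG
  · exact potMult_exists_leadingTermClauses_and_tameBranchPAdicGrossZagierAt_of_delbourgoDatumFact hFact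
      hmodD hGZK hpm hp2 hr
  · by_cases he : semistabilityIndex W p = 2
    · have hodd : p % 4 = 1 ∨ p % 4 = 3 := by
        obtain ⟨k, hk⟩ := hp.out.odd_of_ne_two hp2
        omega
      rcases hodd with h1 | h3
      · exact exists_leadingTermClauses_and_tameBranchPAdicGrossZagierAt_of_delbourgoDatumFact hFact hmodD
          hGZK h1 hcm hadd hG he hr
      · exact exists_leadingTermClauses_and_tameBranchPAdicGrossZagierAt_of_delbourgoDatumFact_odd hFact
          hmodD hGZK h3 hp5 hcm hadd hG he hr
    · exact hFact2 W p hp5 hcm hadd hG he hr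

/-- **L3.N1″ HEADLINE SUPPLIED on the whole potentially-ordinary additive locus, `p ≥ 5`, rank one:**
the LOWER half `ord_p #Ш_an ≤ ord_p #Ш` (`Typed.MissingLowerBoundAt W p`) from PRINT (Delbourgo 2002
(A)(B) `hDel`/`hDelM`, (C) `hC` via `tameBranchRatDvdAt_of_thmC`, GZK, `hmodD`) + the two displayed cell
inputs `hFact`, `hFact2` + per pair ONE certified E-normalised tame branch (`B` `p`-integral,
`‖[T¹]B‖_p = 1`), `ord_p ϖ ≤ 0`, non-CM, non-anomalous, `#Ш_an = s`. Image-free, defect-free,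
parity-free. Nothing booked. [cite: Delbourgo2002, Theorem (A), (B), (C) (p. 40)] [cite: Miller2011LMS, Def. 1.1] -/
theorem missingLowerBoundAt_rankOne_of_cellFacts_of_thmC_of_cert
    (hFact : delbourgoDatum_rankOne_leadingTerms) (hFact2 : tameBranch_delbourgoDatum_rankOne_leadingTerms)
    (hC : Delbourgo2002.thmC_charIdeal_dvd_tameBranch) (hDel : Delbourgo2002.mainTheorem)
    (hDelM : Delbourgo2002.mainTheorem_potMult) (hmodD : nonempty_modularParametrizationData)
    (hGZK : rank_eq_analyticRank_of_analyticRank_le_one)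
    (hp5 : 5 ≤ p) (hcm : ¬ W.HasCM) (hadd : Addv W p) (hloc : AdditivePotMult.PotMult W p ∨ TypeGOrd W p)
    (hr : W.analyticRank = 1) (hna : ReductionNonAnomalous W p)
    {N : ℕ} [NeZero N] {f : CuspForm (Gamma0 N) 2} {ε : DirichletCharacter ℂ_[p] p} {α : ℚ_[p]}
    {B : PowerSeries ℚ_[p]}
    (hf : IsNewformOf W f) (hε : orderOf ε = tameDefect W p) (hα : ‖α‖ = 1)
    (hB : IsTameBranchOf f p ε α B) (hint : ∀ j : ℕ, ‖PowerSeries.coeff j B‖ ≤ 1)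
    (hunit : ‖PowerSeries.coeff 1 B‖ = 1)
    (ϖ : ℚ) (hϖ : (ϖ : ℝ) * W.realPeriodRat = plusPeriod f) (hϖv : padicValRat p ϖ ≤ 0)
    {s : ℚ} (hs : shaAn W = (s : ℂ)) :
    MissingLowerBoundAt W p := by
  have hp2 : p ≠ 2 := by omega
  obtain ⟨Dh, hBcl, hGZ⟩ := exists_leadingTermClauses_and_tameBranchPAdicGrossZagierAt_of_cellFacts hFact
    hFact2 hmodD hGZK hp5 hcm hadd hloc hr
  have hloc' : PotMult W p ∨ TypeGOrd W p := by
    rcases hloc with hpm | hG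
    · exact Or.inl hpm.2
    · exact Or.inr hG
  have hA : ∀ (κ : ZpExtension ℚ p) (γ : Field.absoluteGaloisGroup ℚ),
      κ.IsCyclotomic → κ.IsTopGenerator γ → ∀ D : W.SelmerDualData κ γ, D.IsTorsion := by
    intro κ γ hκ hγ D
    rcases hloc with hpm | hG
    · exact AdditivePotMult.PotMult.isTorsion_of_delbourgo2002 hDelM hpm hp2 hκ hγ D
    · exact hDel.isTorsion hp5 hcm hadd hG hκ hγ D
  exact missingLowerBoundAt_rankOne_of_tameBranchRatDvdAt_of_tameBranchPAdicGrossZagier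
    (tameBranchRatDvdAt_of_thmC hC hDel hDelM hp5 hcm) hp2 hadd hloc' hf hε hα hB hint hunit ϖ hϖ hϖv hBcl
    hGZ hA hGZK hr hna hs

end Summit.BirchSwinnertonDyer.Rank1Residual.Additive

end
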